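import Literature.Combinatorics.Optimization.ShellLawPopulationMixture
import Literature.Combinatorics.Optimization.ShellLawHalfPinning
import Literature.Probability.Distributions.BinomialSmoothingProfile
import HarnessLib

/-!
# Level-smoothness of the shell law of a block WITHOUT internal edges, on any stable ground set, at every
# level index and for both parities

Cell pnp-psdrank (engine seat g24; eng MEMO-23 §2, the Literature half of bricks (T-K)/(T-K2)/(T-K3)). Fix a
fixed-point-free involution `π` (a perfect matching), a `π`-stable ground set `S` with `N` edges (`|S| = 2N`) and
a block `H` such that no edge of `S` lies inside `H` (`H`-type `(0,b,d)`, `b = |reps(vBH ∪ vBN)|` edges of `S`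
meeting `H`). Along the levels `c = c₀ + 2j` of a cut of size `t = 2s₀ + c₀` (`c₀ = 1`: odd cut, odd levels;
`c₀ = 0`: even cut, even levels; any `c₀` is allowed) the shell law `law_S(t, c; y)` of `|U ∩ H|` is the
`Bin(c₀+2j, ½)`-average of the level-`0` (hypergeometric) kernel `K ↦ law_S(2K, 0; y)` over `K ∈ [s₀−j, s₀+j+c₀]`
(`ShellLawPopulationMixture.shellLaw_eq_binomialMixture_levelZero`), one level step is one quarter Laplacian of
the kernel (`BinomialSmoothingProfile`, here for a general parity offset `c₀`), the kernel is a product of `b`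
linear factors in `K` with roots in `[0,b) ∪ (N−b, N]` (`hypergeomPopulationKernel_eq_prod`), hence
`(b/R)^{2k}e^{3bk/R}`-smooth wherever the roots are `R + 3k` away (`abs_laplaceQuarter_iter_prodKernel_le`):

* §1 `fwdDiff_binomialProfile_offset`, `fwdDiff_iter_binomialProfile_offset` (the exact heat equation for the
  profile with `c₀ + 2j` coins), `abs_fwdDiff_iter_binomialProfile_offset_le` (transfer of a pointwise relative
  kernel bound on the window to the profile at index `j`).
* §2 **`abs_fwdDiff_iter_shellLaw_le`** — for `R ≥ 1`, `R + 3k + b + j ≤ s₀ + 1`, `R + 3k + b + s₀ + j + c₀ ≤ N`: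
  `|Δ^k_{j'}[law_S(2s₀+c₀, c₀+2j'; y)](j)| ≤ (¼(b/R)²e^{3b/R})^k · law_S(2s₀+c₀, c₀+2j; y)` at EVERY `y ∈ [0,t]`.
* §3 `sum_shellLaw_le_one'` (total mass `≤ 1`), `fwdDiff_iter_one_shellInAvg_eq` (with `ShellLawHalfPinning`'s
  `shellInAvg_eq_sum_mul_shellLaw`), **`sum_abs_fwdDiff_iter_shellLaw_le`** (the `ℓ¹` form `≤ q^k`) and
  **`abs_fwdDiff_iter_one_shellInAvg_le`**: `|Δ^k_{j'}[E_{Shell_S(t,c₀+2j')}[ψ(|U∩H|)]](j)| ≤ G·q^k` for `|ψ| ≤ G`.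
* §4 (v2) SHIFTED MIXTURES (the shape the `HH`-class reduction (K0) produces — a mask evaluated at `x`, the inner law
  at `x − m`): `shellLaw_eq_zero_of_not_mem_Icc`, **`abs_fwdDiff_iter_shellLaw_le_int`** (§2 at EVERY `y ∈ ℤ`),
  `sum_shellLaw_sub_le_one` (mass `≤ 1` after an integer shift), `fwdDiff_iter_one_sum_mul` (linearity),
  **`abs_fwdDiff_iter_shiftedMixture_le`** (`|Δ^k_{j'}[Σ_{x∈X} ψ(x)·law_S(t, c₀+2j'; x − m)](j)| ≤ G·q^k`), and the
  brick-121 input **`sum_centralBinom_mul_abs_fwdDiff_iter_shellLaw_le`** (odd cut, base index: for `(b/R)²e^{3b/R} ≤ 2`,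
  `Σ_{k=1}^{D} (C(2k,k)/4^k)·|Δ^k_{j}[law_S(2s₀+1, 1+2j; x)](0)| ≤ law_S(2s₀+1, 1; x)` at EVERY `x ∈ ℤ`).

The ground set `univ`, `c₀ = 1` cases are bricks (T-K) §2 (`j = 0`) and (T-K2) §2 of
`Summits/PneNP/PneNP/Theorems/ChebyshevTracialDesignSmallBlock{VirtualPositivity,MaskPricing}`; the general
ground set and parity are what the `HH`-class reduction (K0) of a block WITH internal edges produces (inner
shells on `S ∖ vAA`, even inner cuts for an odd number of half `HH`-edges). All PROVED, 0 sorry, no definitions.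
Instrument/support material for the OPEN crux `TracialDecayExp20`; nothing here is about psd rank or P vs NP.

## References
* [Rothvoss2017] T. Rothvoß, *The matching polytope has exponential extension complexity*, J. ACM 64 (2017),
  §2 (PDF pp. 5–6): cuts, levels, the shell structure.
* [Feller1968] W. Feller, *An Introduction to Probability Theory and Its Applications* I, 3rd ed. (1968), Ch. III
  §2 (the symmetric random walk; two more fair steps = the `¼,½,¼` smoothing).
* [ChattamvelliShanmugam2020] R. Chattamvelli, R. Shanmugam, *Discrete Distributions in Engineering and the
  Applied Sciences* (2020), §7.4 (the hypergeometric law in its population parameter).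
* [RollinRoss2010] A. Röllin, N. Ross, *Local limit theorems via Landau–Kolmogorov inequalities*, Bernoulli 21
  (2015) / arXiv:1011.3100, §3 Lemma 3.1 (the `ℓ¹` smoothness functional and its duality).
-/

noncomputable section

open Finset Polynomial

namespace Literature.Combinatorics.Optimization

namespace ShellStep

open Literature.Combinatorics.StablePolynomials (hyperGen coeff_hyperGen)
open Literature.Probability.Distributions.BinomialSmoothing

variable {n : ℕ} {π : Fin n → Fin n}

/-! ### §1 The binomial smoothing profile with a parity offset -/

/-- **One level step is one quarter Laplacian** (parity offset `c₀`): for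
`P_φ(j) = Σ_{w ≤ c₀+2j} C(c₀+2j,w)2^{−(c₀+2j)} φ(s₀−j+w)`, `P_φ(j+1) − P_φ(j) = P_{Lφ}(j)`,
`(Lφ)(K) = (φ(K−1) − 2φ(K) + φ(K+1))/4`. [cite: Feller1968, Ch. III §2 (the symmetric random walk)] -/
theorem fwdDiff_binomialProfile_offset (φ : ℤ → ℝ) (s₀ : ℤ) (c₀ j : ℕ) :
    fwdDiff (1 : ℕ) (fun j : ℕ => ∑ w ∈ range (c₀ + 2 * j + 1), ((c₀ + 2 * j).choose w : ℝ) / 2 ^ (c₀ + 2 * j) *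
        φ (s₀ - j + w)) j =
      ∑ w ∈ range (c₀ + 2 * j + 1), ((c₀ + 2 * j).choose w : ℝ) / 2 ^ (c₀ + 2 * j) *
        (fun K : ℤ => (φ (K - 1) - 2 * φ K + φ (K + 1)) / 4) (s₀ - j + w) := by
  rw [fwdDiff]
  have e : ∑ w ∈ range (c₀ + 2 * (j + 1) + 1), ((c₀ + 2 * (j + 1)).choose w : ℝ) / 2 ^ (c₀ + 2 * (j + 1)) *
      φ (s₀ - ((j + 1 : ℕ) : ℤ) + w) =
      ∑ w ∈ range ((c₀ + 2 * j) + 3), (((c₀ + 2 * j) + 2).choose w : ℝ) / 2 ^ ((c₀ + 2 * j) + 2) *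
        φ ((s₀ - j) - 1 + w) := by
    rw [show c₀ + 2 * (j + 1) + 1 = (c₀ + 2 * j) + 3 by ring, show c₀ + 2 * (j + 1) = (c₀ + 2 * j) + 2 by ring]
    refine sum_congr rfl fun w _ => ?_
    push_cast; ring_nf
  rw [e, binomialAvg_succ_succ φ (c₀ + 2 * j) (s₀ - j), ← sum_sub_distrib]
  refine sum_congr rfl fun w _ => ?_
  simp only
  ring

/-- **The iterated heat equation** (parity offset `c₀`): `Δ^k_j P_φ(j) = P_{L^kφ}(j)`.
[cite: Feller1968, Ch. III §2 (the symmetric random walk)] -/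
theorem fwdDiff_iter_binomialProfile_offset (c₀ k : ℕ) : ∀ (φ : ℤ → ℝ) (s₀ : ℤ) (j : ℕ),
    (fwdDiff (1 : ℕ))^[k] (fun j : ℕ => ∑ w ∈ range (c₀ + 2 * j + 1), ((c₀ + 2 * j).choose w : ℝ) / 2 ^ (c₀ + 2 * j) *
        φ (s₀ - j + w)) j =
      ∑ w ∈ range (c₀ + 2 * j + 1), ((c₀ + 2 * j).choose w : ℝ) / 2 ^ (c₀ + 2 * j) *
        ((fun ψ : ℤ → ℝ => fun K : ℤ => (ψ (K - 1) - 2 * ψ K + ψ (K + 1)) / 4)^[k] φ) (s₀ - j + w) := by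
  induction k with
  | zero => intro φ s₀ j; simp
  | succ k ih =>
    intro φ s₀ j
    rw [Function.iterate_succ_apply, Function.iterate_succ_apply]
    have hfun : fwdDiff (1 : ℕ) (fun j : ℕ => ∑ w ∈ range (c₀ + 2 * j + 1),
        ((c₀ + 2 * j).choose w : ℝ) / 2 ^ (c₀ + 2 * j) * φ (s₀ - j + w)) =
        fun j : ℕ => ∑ w ∈ range (c₀ + 2 * j + 1), ((c₀ + 2 * j).choose w : ℝ) / 2 ^ (c₀ + 2 * j) *
          (fun K : ℤ => (φ (K - 1) - 2 * φ K + φ (K + 1)) / 4) (s₀ - j + w) := by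
      funext j'; exact fwdDiff_binomialProfile_offset φ s₀ c₀ j'
    rw [hfun]
    exact ih (fun K : ℤ => (φ (K - 1) - 2 * φ K + φ (K + 1)) / 4) s₀ j

/-- **Transfer of a pointwise relative kernel bound to the profile at index `j`** (parity offset `c₀`): if on the
window `K ∈ {s₀−j, …, s₀+j+c₀}` the kernel satisfies `|(L^kφ)(K)| ≤ ρ·φ(K)`, then `|Δ^k_j P_φ(j)| ≤ ρ·P_φ(j)`.
[cite: Feller1968, Ch. III §2 (the symmetric random walk)] -/
theorem abs_fwdDiff_iter_binomialProfile_offset_le (φ : ℤ → ℝ) (s₀ : ℤ) (c₀ k j : ℕ) {ρ : ℝ}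
    (hbd : ∀ w ∈ range (c₀ + 2 * j + 1),
      |((fun ψ : ℤ → ℝ => fun K : ℤ => (ψ (K - 1) - 2 * ψ K + ψ (K + 1)) / 4)^[k] φ) (s₀ - j + w)| ≤
        ρ * φ (s₀ - j + w)) :
    |(fwdDiff (1 : ℕ))^[k] (fun j : ℕ => ∑ w ∈ range (c₀ + 2 * j + 1), ((c₀ + 2 * j).choose w : ℝ) / 2 ^ (c₀ + 2 * j) *
        φ (s₀ - j + w)) j| ≤
      ρ * ∑ w ∈ range (c₀ + 2 * j + 1), ((c₀ + 2 * j).choose w : ℝ) / 2 ^ (c₀ + 2 * j) * φ (s₀ - j + w) := by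
  rw [fwdDiff_iter_binomialProfile_offset c₀ k φ s₀ j, mul_sum]
  refine (abs_sum_le_sum_abs _ _).trans (sum_le_sum fun w hw => ?_)
  have hc : (0 : ℝ) ≤ ((c₀ + 2 * j).choose w : ℝ) / 2 ^ (c₀ + 2 * j) := by positivity
  rw [abs_mul, abs_of_nonneg hc]
  calc ((c₀ + 2 * j).choose w : ℝ) / 2 ^ (c₀ + 2 * j) *
        |((fun ψ : ℤ → ℝ => fun K : ℤ => (ψ (K - 1) - 2 * ψ K + ψ (K + 1)) / 4)^[k] φ) (s₀ - j + w)|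
      ≤ ((c₀ + 2 * j).choose w : ℝ) / 2 ^ (c₀ + 2 * j) * (ρ * φ (s₀ - j + w)) :=
        mul_le_mul_of_nonneg_left (hbd w hw) hc
    _ = ρ * (((c₀ + 2 * j).choose w : ℝ) / 2 ^ (c₀ + 2 * j) * φ (s₀ - j + w)) := by ring

/-! ### §2 The level differences of the shell law of a block without internal edges -/

section Main

variable (hπ : ∀ v, π (π v) = v) (hπ' : ∀ v, π v ≠ v)
include hπ hπ'

/-- **THE `k`-FOLD LEVEL DIFFERENCE OF THE SHELL LAW OF A BLOCK WITHOUT INTERNAL EDGES, on any stable ground set,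
at every level index, for both parities.** Let `S` be `π`-stable with `|S| = 2N`, `H` a block with no edge of `S`
inside it and `b` edges of `S` meeting it, `t = 2s₀ + c₀` the cut size (levels `c = c₀ + 2j`), `k` an order, `j`
an index, and `R ≥ 1` an integer with `R + 3k + b + j ≤ s₀ + 1` and `R + 3k + b + s₀ + j + c₀ ≤ N`. Then for every
`y ∈ [0,t]`: `|Δ^k_{j'}[law_S(t, c₀+2j'; y)](j)| ≤ (¼(b/R)²e^{3b/R})^k · law_S(t, c₀+2j; y)`.
(Population mixture at index `j` ∘ exact heat equation ∘ far-roots smoothness of the hypergeometric kernel in its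
population parameter on the window `[s₀−j, s₀+j+c₀]` ∘ transfer.)
[cite: Rothvoss2017, §2 (PDF p. 6)] [cite: ChattamvelliShanmugam2020, §7.4 Table 7.1] [cite: Feller1968, Ch. III §2] -/
theorem abs_fwdDiff_iter_shellLaw_le {S : Finset (Fin n)} (hS : ∀ v ∈ S, π v ∈ S) {N : ℕ} (hN : S.card = 2 * N)
    (H : Finset (Fin n)) (h0 : (reps π (vAA π S H)).card = 0) {b : ℕ}
    (hb : (reps π (vBH π S H ∪ vBN π S H)).card = b) {c₀ s₀ k j R : ℕ} (hR : 1 ≤ R)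
    (hR1 : R + 3 * k + b + j ≤ s₀ + 1) (hR2 : R + 3 * k + b + s₀ + j + c₀ ≤ N) :
    ∀ y ∈ Icc (0 : ℤ) ((2 * s₀ + c₀ : ℕ) : ℤ),
      |(fwdDiff (1 : ℕ))^[k] (fun j' => shellLaw π S H (2 * s₀ + c₀) (c₀ + 2 * j') y) j| ≤
        ((1 / 4 : ℝ) * ((b : ℝ) / R) ^ 2 * Real.exp (3 * b / R)) ^ k * shellLaw π S H (2 * s₀ + c₀) (c₀ + 2 * j) y := by
  classical
  intro y hy
  obtain ⟨m, rfl⟩ : ∃ m : ℕ, y = (m : ℤ) := Int.eq_ofNat_of_zero_le (mem_Icc.1 hy).1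
  have hA := noHH_of_card_reps_vAA_eq_zero hπ hπ' hS H h0
  -- the type: `a = 0`, `b` mixed, `d = N − b`
  have hd : (reps π (vDD π S H)).card = N - b := by
    have h2 := two_mul_typeReps_eq_card hπ hπ' hS H
    rw [h0, hb, hN] at h2
    omega
  have hbN : b ≤ N := by omega
  have hRpos : (0 : ℝ) < R := by exact_mod_cast hR
  /- ───── the kernel `ψ(K) = c·Π_{i<b}(K − r_i)` ───── -/
  obtain ⟨root, hroot⟩ : ∃ f : ℕ → ℝ, f = fun i => if i < m then (i : ℝ) else (N : ℝ) - ((i - m : ℕ) : ℝ) := ⟨_, rfl⟩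
  obtain ⟨c, hc⟩ : ∃ e : ℝ, e = ((b.choose m : ℕ) : ℝ) * (-1) ^ (b - m) / N.descFactorial b := ⟨_, rfl⟩
  obtain ⟨ψ, hψ⟩ : ∃ g : ℤ → ℝ, g = fun K : ℤ => c * ∏ i ∈ range b, (((K : ℤ) : ℝ) - root i) := ⟨_, rfl⟩
  -- (S1) the level-`0` laws on the window `[s₀ − j − k, s₀ + j + c₀ + k]` are the kernel
  have hker : ∀ K : ℤ, (s₀ : ℤ) - j - k ≤ K → K ≤ (s₀ : ℤ) + j + c₀ + k →
      shellLaw π S H (2 * K.toNat) 0 (m : ℤ) = ψ K := by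
    intro K hK1 hK2
    have hK0 : 0 ≤ K := by
      have : (j : ℤ) + k ≤ s₀ := by exact_mod_cast (show j + k ≤ s₀ by omega)
      linarith
    obtain ⟨Kn, rfl⟩ : ∃ Kn : ℕ, K = (Kn : ℤ) := Int.eq_ofNat_of_zero_le hK0
    rw [Int.toNat_natCast]
    have hKn1 : b ≤ Kn := by
      have h' : (s₀ : ℤ) ≤ Kn + j + k := by linarith
      have h'' : s₀ ≤ Kn + j + k := by exact_mod_cast h'
      omega
    have hKn2 : Kn + b ≤ N := by
      have h' : (Kn : ℤ) ≤ s₀ + j + c₀ + k := hK2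
      have h'' : Kn ≤ s₀ + j + c₀ + k := by exact_mod_cast h'
      omega
    rw [shellLaw_zero_eq hπ hπ' hS hN H h0 Kn m, hb, hd, coeff_hyperGen, hψ, hc, hroot]
    by_cases hm : m ≤ b
    · rw [if_pos (by omega : m ≤ Kn)]
      have hk := hypergeomPopulationKernel_eq_prod (N := N) hm hKn1 hKn2
      push_cast at hk ⊢
      rw [hk]
    · have hz : b.choose m = 0 := Nat.choose_eq_zero_of_lt (by omega)
      simp [hz]
  -- (S2) the level laws are the binomial smoothing profile of `ψ`, at every index `i ≤ j + k`
  have hprof : ∀ i : ℕ, i ≤ j + k →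
      shellLaw π S H (2 * s₀ + c₀) (c₀ + 2 * i) (m : ℤ) =
        ∑ w ∈ range (c₀ + 2 * i + 1), ((c₀ + 2 * i).choose w : ℝ) / 2 ^ (c₀ + 2 * i) * ψ ((s₀ : ℤ) - i + w) := by
    intro i hi
    have his : i ≤ s₀ := by omega
    rw [show 2 * s₀ + c₀ = 2 * (s₀ - i) + (c₀ + 2 * i) by omega,
      shellLaw_eq_binomialMixture_levelZero hπ hπ' hS hN hA (by omega : (s₀ - i) + (c₀ + 2 * i) ≤ N) (m : ℤ)]
    refine sum_congr rfl fun w hw => ?_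
    have hw' : w ≤ c₀ + 2 * i := Nat.lt_succ_iff.1 (mem_range.1 hw)
    have hi' : (i : ℤ) ≤ j + k := by exact_mod_cast hi
    have hwz : (w : ℤ) ≤ c₀ + 2 * i := by exact_mod_cast hw'
    rw [← hker ((s₀ : ℤ) - i + w) (by linarith [Int.natCast_nonneg w]) (by linarith)]
    congr 2
    have : ((s₀ : ℤ) - i + w).toNat = s₀ - i + w := by omega
    rw [this]
  -- (S3) hence the same forward differences at `j` (locality: only `j ≤ i ≤ j + k` is sampled)
  have hΔ : (fwdDiff (1 : ℕ))^[k] (fun j' => shellLaw π S H (2 * s₀ + c₀) (c₀ + 2 * j') (m : ℤ)) j =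
        (fwdDiff (1 : ℕ))^[k] (fun j' : ℕ => ∑ w ∈ range (c₀ + 2 * j' + 1),
          ((c₀ + 2 * j').choose w : ℝ) / 2 ^ (c₀ + 2 * j') * ψ ((s₀ : ℤ) - j' + w)) j := by
    rw [fwdDiff_iter_eq_sum_shift, fwdDiff_iter_eq_sum_shift]
    refine sum_congr rfl fun i hi => ?_
    have hi' : i ≤ k := Nat.lt_succ_iff.1 (mem_range.1 hi)
    congr 1
    simp only [smul_eq_mul, mul_one]
    exact hprof (j + i) (by omega)
  -- (S4) far-roots smoothness of the kernel on the window `K₁ ∈ [s₀ − j, s₀ + j + c₀]`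
  have hψpoly : ∀ K : ℤ, ψ K = c * (∏ i ∈ range b, (Polynomial.X - Polynomial.C (root i))).eval (K : ℝ) := by
    intro K; rw [hψ, Polynomial.eval_prod]; simp
  have hψnn : ∀ w ∈ range (c₀ + 2 * j + 1), 0 ≤ ψ ((s₀ : ℤ) - j + w) := by
    intro w hw
    have hw' : w ≤ c₀ + 2 * j := Nat.lt_succ_iff.1 (mem_range.1 hw)
    have hwz : (w : ℤ) ≤ c₀ + 2 * j := by exact_mod_cast hw'
    rw [← hker ((s₀ : ℤ) - j + w) (by linarith [Int.natCast_nonneg w, Int.natCast_nonneg k])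
      (by linarith [Int.natCast_nonneg k])]
    rw [shellLaw, shellCount]; positivity
  have hfar : ∀ w ∈ range (c₀ + 2 * j + 1), ∀ i, i < b →
      (R : ℝ) + 3 * k ≤ |((((s₀ : ℤ) - j + w : ℤ)) : ℝ) - root i| := by
    intro w hw i hi
    have hw' : w ≤ c₀ + 2 * j := Nat.lt_succ_iff.1 (mem_range.1 hw)
    have hK₁lo : (s₀ : ℝ) - j ≤ ((((s₀ : ℤ) - j + w : ℤ)) : ℝ) ∧ ((((s₀ : ℤ) - j + w : ℤ)) : ℝ) ≤ s₀ + j + c₀ := by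
      have hwr : (w : ℝ) ≤ c₀ + 2 * j := by exact_mod_cast hw'
      push_cast
      constructor <;> linarith [(Nat.cast_nonneg w : (0 : ℝ) ≤ w)]
    have hR1' : (R : ℝ) + 3 * k + b + j ≤ s₀ + 1 := by exact_mod_cast hR1
    have hR2' : (R : ℝ) + 3 * k + b + s₀ + j + c₀ ≤ N := by exact_mod_cast hR2
    have hib : (i : ℝ) + 1 ≤ b := by exact_mod_cast hi
    rw [hroot]
    simp only
    split_ifs with him
    · -- root `i ≤ b − 1` below the window
      rw [abs_of_nonneg (by linarith [hK₁lo.1])]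
      linarith [hK₁lo.1]
    · -- root `N − (i − m) ≥ N − b + 1` above the window
      have him' : ((i - m : ℕ) : ℝ) ≤ i := by
        have : i - m ≤ i := Nat.sub_le _ _
        exact_mod_cast this
      rw [abs_of_nonpos (by linarith [hK₁lo.2])]
      linarith [hK₁lo.2]
  have hbd : ∀ w ∈ range (c₀ + 2 * j + 1),
      |((fun φ : ℤ → ℝ => fun K : ℤ => (φ (K - 1) - 2 * φ K + φ (K + 1)) / 4)^[k] ψ) ((s₀ : ℤ) - j + w)| ≤
        ((1 / 4 : ℝ) ^ k * (((b : ℝ) / R) ^ (2 * k) * Real.exp (b * (2 * k : ℕ) / R)) * Real.exp (b * k / R)) *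
          ψ ((s₀ : ℤ) - j + w) := by
    intro w hw
    have h := abs_laplaceQuarter_iter_prodKernel_le root b k c hRpos ψ hψpoly ((s₀ : ℤ) - j + w) (hfar w hw)
    rwa [abs_of_nonneg (hψnn w hw)] at h
  -- (S5) transfer to the profile at index `j`
  have hT := abs_fwdDiff_iter_binomialProfile_offset_le ψ (s₀ : ℤ) c₀ k j hbd
  -- (S6) the smoothness constant is `q^k`
  have hρ : (1 / 4 : ℝ) ^ k * (((b : ℝ) / R) ^ (2 * k) * Real.exp (b * (2 * k : ℕ) / R)) *
      Real.exp (b * k / R) = ((1 / 4 : ℝ) * ((b : ℝ) / R) ^ 2 * Real.exp (3 * b / R)) ^ k := by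
    have e1 : ((b : ℝ) / R) ^ (2 * k) = (((b : ℝ) / R) ^ 2) ^ k := pow_mul _ 2 k
    have e2 : Real.exp (b * ((2 * k : ℕ) : ℝ) / R) * Real.exp (b * k / R) = Real.exp (3 * b / R) ^ k := by
      rw [← Real.exp_add, ← Real.exp_nat_mul]
      congr 1
      push_cast
      ring
    rw [mul_pow, mul_pow, e1, mul_assoc, mul_assoc, e2]
    ring
  rw [hΔ]
  exact hT.trans (le_of_eq (by rw [hρ, ← hprof j (Nat.le_add_right j k)]))

end Main

/-! ### §3 The `ℓ¹` form and the shell profile of a bounded mask -/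

/-- **The shell law has total mass at most one** on every set of values. [cite: Rothvoss2017, §2 (PDF p. 6)] -/
theorem sum_shellLaw_le_one' (π : Fin n → Fin n) (S H : Finset (Fin n)) (t c : ℕ) (X : Finset ℤ) :
    ∑ x ∈ X, shellLaw π S H t c x ≤ 1 := by
  classical
  simp only [shellLaw, shellCount]
  rw [← sum_div]
  rcases Nat.eq_zero_or_pos (shellIn π S t c).card with h0 | hpos
  · rw [h0, Nat.cast_zero, div_zero]; exact zero_le_one
  rw [div_le_one (by exact_mod_cast hpos)]
  have hfw := card_eq_sum_card_fiberwise
    (s := (shellIn π S t c).filter fun U => ((U ∩ H).card : ℤ) ∈ X)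
    (f := fun U => ((U ∩ H).card : ℤ)) (t := X) (fun U hU => (mem_filter.1 hU).2)
  have h1 : ∑ x ∈ X, ((((shellIn π S t c).filter fun U => ((U ∩ H).card : ℤ) = x).card : ℕ) : ℝ) =
      ((((shellIn π S t c).filter fun U => ((U ∩ H).card : ℤ) ∈ X).card : ℕ) : ℝ) := by
    rw [hfw]; push_cast
    refine sum_congr rfl fun x hx => ?_
    congr 2
    rw [filter_filter]
    ext U
    simp only [mem_filter]
    constructor
    · rintro ⟨hU, h⟩; exact ⟨hU, by rw [h]; exact hx, h⟩
    · rintro ⟨hU, _, h⟩; exact ⟨hU, h⟩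
  rw [h1]
  exact_mod_cast card_filter_le _ _

/-- Level differences of the shell profile of a mask: `Δ^k_{j'}[E_{Shell_S(t,c(j'))}[ψ(|U∩H|)]](j) =
Σ_{x=0}^{t} ψ(x)·Δ^k_{j'}[law_S(t,c(j');x)](j)` for any level parametrisation `c(·)`. [cite: Rothvoss2017, §2 (PDF p. 6)] -/
theorem fwdDiff_iter_one_shellInAvg_eq (π : Fin n → Fin n) (S H : Finset (Fin n)) (t k j : ℕ) (lev : ℕ → ℕ)
    (ψ : ℤ → ℝ) :
    (fwdDiff (1 : ℕ))^[k] (fun j' => (∑ U ∈ shellIn π S t (lev j'), ψ ((U ∩ H).card : ℤ)) /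
        ((shellIn π S t (lev j')).card : ℝ)) j =
      ∑ x ∈ Icc (0 : ℤ) t, ψ x * (fwdDiff (1 : ℕ))^[k] (fun j' => shellLaw π S H t (lev j') x) j := by
  have hfun : (fun j' => (∑ U ∈ shellIn π S t (lev j'), ψ ((U ∩ H).card : ℤ)) /
      ((shellIn π S t (lev j')).card : ℝ)) = fun j' => ∑ x ∈ Icc (0 : ℤ) t, ψ x * shellLaw π S H t (lev j') x := by
    funext j'; exact shellInAvg_eq_sum_mul_shellLaw S H t (lev j') ψ
  have hR : ∀ x : ℤ, (fwdDiff (1 : ℕ))^[k] (fun j' => shellLaw π S H t (lev j') x) j =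
      ∑ i ∈ range (k + 1), ((-1 : ℤ) ^ (k - i) * (k.choose i : ℤ)) • shellLaw π S H t (lev (j + i • 1)) x := by
    intro x; rw [fwdDiff_iter_eq_sum_shift]
  rw [hfun, fwdDiff_iter_eq_sum_shift]
  simp only [hR, zsmul_eq_mul, mul_sum]
  exact Finset.sum_comm.trans (sum_congr rfl fun x _ => sum_congr rfl fun i _ => by ring)

section MainL1

variable (hπ : ∀ v, π (π v) = v) (hπ' : ∀ v, π v ≠ v)
include hπ hπ'

/-- **The `ℓ¹` form**: under the hypotheses of `abs_fwdDiff_iter_shellLaw_le`,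
`Σ_{y=0}^{t} |Δ^k_{j'}[law_S(t, c₀+2j'; y)](j)| ≤ (¼(b/R)²e^{3b/R})^k`.
[cite: Rothvoss2017, §2 (PDF p. 6)] [cite: RollinRoss2010, §3 (Lemma 3.1)] -/
theorem sum_abs_fwdDiff_iter_shellLaw_le {S : Finset (Fin n)} (hS : ∀ v ∈ S, π v ∈ S) {N : ℕ}
    (hN : S.card = 2 * N) (H : Finset (Fin n)) (h0 : (reps π (vAA π S H)).card = 0) {b : ℕ}
    (hb : (reps π (vBH π S H ∪ vBN π S H)).card = b) {c₀ s₀ k j R : ℕ} (hR : 1 ≤ R)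
    (hR1 : R + 3 * k + b + j ≤ s₀ + 1) (hR2 : R + 3 * k + b + s₀ + j + c₀ ≤ N) :
    ∑ y ∈ Icc (0 : ℤ) ((2 * s₀ + c₀ : ℕ) : ℤ),
        |(fwdDiff (1 : ℕ))^[k] (fun j' => shellLaw π S H (2 * s₀ + c₀) (c₀ + 2 * j') y) j| ≤
      ((1 / 4 : ℝ) * ((b : ℝ) / R) ^ 2 * Real.exp (3 * b / R)) ^ k := by
  have hq0 : (0 : ℝ) ≤ ((1 / 4 : ℝ) * ((b : ℝ) / R) ^ 2 * Real.exp (3 * b / R)) ^ k := by positivity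
  calc ∑ y ∈ Icc (0 : ℤ) ((2 * s₀ + c₀ : ℕ) : ℤ),
          |(fwdDiff (1 : ℕ))^[k] (fun j' => shellLaw π S H (2 * s₀ + c₀) (c₀ + 2 * j') y) j|
      ≤ ∑ y ∈ Icc (0 : ℤ) ((2 * s₀ + c₀ : ℕ) : ℤ),
          ((1 / 4 : ℝ) * ((b : ℝ) / R) ^ 2 * Real.exp (3 * b / R)) ^ k * shellLaw π S H (2 * s₀ + c₀) (c₀ + 2 * j) y :=
        sum_le_sum (abs_fwdDiff_iter_shellLaw_le hπ hπ' hS hN H h0 hb hR hR1 hR2)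
    _ = ((1 / 4 : ℝ) * ((b : ℝ) / R) ^ 2 * Real.exp (3 * b / R)) ^ k *
          ∑ y ∈ Icc (0 : ℤ) ((2 * s₀ + c₀ : ℕ) : ℤ), shellLaw π S H (2 * s₀ + c₀) (c₀ + 2 * j) y := by rw [mul_sum]
    _ ≤ ((1 / 4 : ℝ) * ((b : ℝ) / R) ^ 2 * Real.exp (3 * b / R)) ^ k * 1 :=
        mul_le_mul_of_nonneg_left (sum_shellLaw_le_one' π S H _ _ _) hq0
    _ = _ := mul_one _

/-- **Level differences of the shell profile of a bounded mask on a block without internal edges** (any stable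
ground set, both parities): for `|ψ| ≤ G` on `[0,t]` and the hypotheses of `abs_fwdDiff_iter_shellLaw_le`,
`|Δ^k_{j'}[E_{Shell_S(t, c₀+2j')}[ψ(|U∩H|)]](j)| ≤ G·(¼(b/R)²e^{3b/R})^k`.
[cite: Rothvoss2017, §2 (PDF p. 6)] [cite: RollinRoss2010, §3 (Lemma 3.1)] -/
theorem abs_fwdDiff_iter_one_shellInAvg_le {S : Finset (Fin n)} (hS : ∀ v ∈ S, π v ∈ S) {N : ℕ}
    (hN : S.card = 2 * N) (H : Finset (Fin n)) (h0 : (reps π (vAA π S H)).card = 0) {b : ℕ}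
    (hb : (reps π (vBH π S H ∪ vBN π S H)).card = b) {c₀ s₀ k j R : ℕ} (hR : 1 ≤ R)
    (hR1 : R + 3 * k + b + j ≤ s₀ + 1) (hR2 : R + 3 * k + b + s₀ + j + c₀ ≤ N)
    (ψ : ℤ → ℝ) {G : ℝ} (hG : ∀ x ∈ Icc (0 : ℤ) ((2 * s₀ + c₀ : ℕ) : ℤ), |ψ x| ≤ G) :
    |(fwdDiff (1 : ℕ))^[k] (fun j' => (∑ U ∈ shellIn π S (2 * s₀ + c₀) (c₀ + 2 * j'), ψ ((U ∩ H).card : ℤ)) /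
        ((shellIn π S (2 * s₀ + c₀) (c₀ + 2 * j')).card : ℝ)) j| ≤
      G * ((1 / 4 : ℝ) * ((b : ℝ) / R) ^ 2 * Real.exp (3 * b / R)) ^ k := by
  have hG0 : 0 ≤ G := (abs_nonneg _).trans (hG 0 (mem_Icc.2 ⟨le_rfl, by positivity⟩))
  rw [fwdDiff_iter_one_shellInAvg_eq π S H (2 * s₀ + c₀) k j (fun j' => c₀ + 2 * j') ψ]
  calc |∑ x ∈ Icc (0 : ℤ) ((2 * s₀ + c₀ : ℕ) : ℤ),
          ψ x * (fwdDiff (1 : ℕ))^[k] (fun j' => shellLaw π S H (2 * s₀ + c₀) (c₀ + 2 * j') x) j|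
      ≤ ∑ x ∈ Icc (0 : ℤ) ((2 * s₀ + c₀ : ℕ) : ℤ),
          |ψ x * (fwdDiff (1 : ℕ))^[k] (fun j' => shellLaw π S H (2 * s₀ + c₀) (c₀ + 2 * j') x) j| :=
        abs_sum_le_sum_abs _ _
    _ ≤ ∑ x ∈ Icc (0 : ℤ) ((2 * s₀ + c₀ : ℕ) : ℤ),
          G * |(fwdDiff (1 : ℕ))^[k] (fun j' => shellLaw π S H (2 * s₀ + c₀) (c₀ + 2 * j') x) j| :=
        sum_le_sum fun x hx => by
          rw [abs_mul]
          exact mul_le_mul_of_nonneg_right (hG x hx) (abs_nonneg _)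
    _ = G * ∑ x ∈ Icc (0 : ℤ) ((2 * s₀ + c₀ : ℕ) : ℤ),
          |(fwdDiff (1 : ℕ))^[k] (fun j' => shellLaw π S H (2 * s₀ + c₀) (c₀ + 2 * j') x) j| := by rw [mul_sum]
    _ ≤ G * ((1 / 4 : ℝ) * ((b : ℝ) / R) ^ 2 * Real.exp (3 * b / R)) ^ k :=
        mul_le_mul_of_nonneg_left (sum_abs_fwdDiff_iter_shellLaw_le hπ hπ' hS hN H h0 hb hR hR1 hR2) hG0

end MainL1

/-! ### §4 (v2) Shifted mixtures: the level laws at `x − m` against a mask at `x` -/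

/-- The shell law vanishes off `[0, t]`: `|U ∩ H| ∈ [0, |U|]`. [cite: Rothvoss2017, §2 (PDF p. 6)] -/
theorem shellLaw_eq_zero_of_not_mem_Icc (π : Fin n → Fin n) (S H : Finset (Fin n)) (t c : ℕ) {x : ℤ}
    (hx : x ∉ Icc (0 : ℤ) t) : shellLaw π S H t c x = 0 := by
  classical
  rw [shellLaw, shellCount]
  have h0 : ((shellIn π S t c).filter fun U => ((U ∩ H).card : ℤ) = x) = ∅ := by
    refine filter_eq_empty_iff.2 fun U hU h => hx ?_
    rw [mem_Icc, ← h]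
    refine ⟨by positivity, ?_⟩
    have h1 : (U ∩ H).card ≤ U.card := card_le_card inter_subset_left
    have h2 : U.card = t := (mem_shellIn.1 hU).2.1
    exact_mod_cast h2 ▸ h1
  rw [h0, card_empty, Nat.cast_zero, zero_div]

section MainInt

variable (hπ : ∀ v, π (π v) = v) (hπ' : ∀ v, π v ≠ v)
include hπ hπ'

/-- **§2 at every integer point**: under the hypotheses of `abs_fwdDiff_iter_shellLaw_le`, for EVERY `y ∈ ℤ`
`|Δ^k_{j'}[law_S(2s₀+c₀, c₀+2j'; y)](j)| ≤ (¼(b/R)²e^{3b/R})^k · law_S(2s₀+c₀, c₀+2j; y)` (off `[0,t]` both sides vanish).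
[cite: Rothvoss2017, §2 (PDF p. 6)] [cite: Feller1968, Ch. III §2] -/
theorem abs_fwdDiff_iter_shellLaw_le_int {S : Finset (Fin n)} (hS : ∀ v ∈ S, π v ∈ S) {N : ℕ} (hN : S.card = 2 * N)
    (H : Finset (Fin n)) (h0 : (reps π (vAA π S H)).card = 0) {b : ℕ}
    (hb : (reps π (vBH π S H ∪ vBN π S H)).card = b) {c₀ s₀ k j R : ℕ} (hR : 1 ≤ R)
    (hR1 : R + 3 * k + b + j ≤ s₀ + 1) (hR2 : R + 3 * k + b + s₀ + j + c₀ ≤ N) (y : ℤ) :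
    |(fwdDiff (1 : ℕ))^[k] (fun j' => shellLaw π S H (2 * s₀ + c₀) (c₀ + 2 * j') y) j| ≤
      ((1 / 4 : ℝ) * ((b : ℝ) / R) ^ 2 * Real.exp (3 * b / R)) ^ k * shellLaw π S H (2 * s₀ + c₀) (c₀ + 2 * j) y := by
  by_cases hy : y ∈ Icc (0 : ℤ) ((2 * s₀ + c₀ : ℕ) : ℤ)
  · exact abs_fwdDiff_iter_shellLaw_le hπ hπ' hS hN H h0 hb hR hR1 hR2 y hy
  · have hz : ∀ c, shellLaw π S H (2 * s₀ + c₀) c y = 0 := fun c =>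
      shellLaw_eq_zero_of_not_mem_Icc π S H (2 * s₀ + c₀) c hy
    have hfun : (fun j' => shellLaw π S H (2 * s₀ + c₀) (c₀ + 2 * j') y) = fun _ => (0 : ℝ) := by
      funext j'; exact hz _
    rw [hfun, hz, fwdDiff_iter_eq_sum_shift]
    simp

end MainInt

/-- **Mass at most one after an integer shift**: `Σ_{x ∈ X} law_S(t, c; x − m) ≤ 1` for every finite `X ⊆ ℤ`, `m ∈ ℤ`.
[cite: Rothvoss2017, §2 (PDF p. 6)] -/
theorem sum_shellLaw_sub_le_one (π : Fin n → Fin n) (S H : Finset (Fin n)) (t c : ℕ) (X : Finset ℤ) (m : ℤ) :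
    ∑ x ∈ X, shellLaw π S H t c (x - m) ≤ 1 := by
  have h := sum_shellLaw_le_one' π S H t c (X.map (addRightEmbedding (-m)))
  rw [sum_map] at h
  simpa [sub_eq_add_neg] using h

/-- Linearity of iterated unit-step differences over a finite mixture: `Δ^k[j ↦ Σ_x a_x F_x(j)] = Σ_x a_x Δ^k F_x`.
[cite: Feller1968, Ch. III §2] -/
theorem fwdDiff_iter_one_sum_mul {ι : Type*} (X : Finset ι) (a : ι → ℝ) (F : ι → ℕ → ℝ) (k j : ℕ) :
    (fwdDiff (1 : ℕ))^[k] (fun j' => ∑ x ∈ X, a x * F x j') j = ∑ x ∈ X, a x * (fwdDiff (1 : ℕ))^[k] (F x) j := by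
  have hR : ∀ x, (fwdDiff (1 : ℕ))^[k] (F x) j =
      ∑ i ∈ range (k + 1), ((-1 : ℤ) ^ (k - i) * (k.choose i : ℤ)) • F x (j + i • 1) := by
    intro x; rw [fwdDiff_iter_eq_sum_shift]
  rw [fwdDiff_iter_eq_sum_shift]
  simp only [hR, zsmul_eq_mul, mul_sum]
  exact Finset.sum_comm.trans (sum_congr rfl fun x _ => sum_congr rfl fun i _ => by ring)

section MainShift

variable (hπ : ∀ v, π (π v) = v) (hπ' : ∀ v, π v ≠ v)
include hπ hπ'

/-- **Level differences of a SHIFTED mixture on a block without internal edges.** For `S` `π`-stable with `|S| = 2N`,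
`H` with no edge of `S` inside and `b` edges meeting it, cut `t = 2s₀ + c₀`, levels `c₀ + 2j`, a finite set `X ⊆ ℤ` of
mask values, weights `|ψ(x)| ≤ G` (`G ≥ 0`) on `X`, an integer shift `m`, and `R ≥ 1`, `R + 3k + b + j ≤ s₀ + 1`,
`R + 3k + b + s₀ + j + c₀ ≤ N`: `|Δ^k_{j'}[Σ_{x∈X} ψ(x)·law_S(t, c₀+2j'; x − m)](j)| ≤ G·(¼(b/R)²e^{3b/R})^k` — the
profile shape produced by the `HH`-class reduction (a mask at `x`, the inner law at `x − (2f+g)`).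
[cite: Rothvoss2017, §2 (PDF p. 6)] [cite: RollinRoss2010, §3 (Lemma 3.1)] -/
theorem abs_fwdDiff_iter_shiftedMixture_le {S : Finset (Fin n)} (hS : ∀ v ∈ S, π v ∈ S) {N : ℕ}
    (hN : S.card = 2 * N) (H : Finset (Fin n)) (h0 : (reps π (vAA π S H)).card = 0) {b : ℕ}
    (hb : (reps π (vBH π S H ∪ vBN π S H)).card = b) {c₀ s₀ k j R : ℕ} (hR : 1 ≤ R)
    (hR1 : R + 3 * k + b + j ≤ s₀ + 1) (hR2 : R + 3 * k + b + s₀ + j + c₀ ≤ N)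
    (X : Finset ℤ) (m : ℤ) (ψ : ℤ → ℝ) {G : ℝ} (hG0 : 0 ≤ G) (hG : ∀ x ∈ X, |ψ x| ≤ G) :
    |(fwdDiff (1 : ℕ))^[k] (fun j' => ∑ x ∈ X, ψ x * shellLaw π S H (2 * s₀ + c₀) (c₀ + 2 * j') (x - m)) j| ≤
      G * ((1 / 4 : ℝ) * ((b : ℝ) / R) ^ 2 * Real.exp (3 * b / R)) ^ k := by
  set q : ℝ := ((1 / 4 : ℝ) * ((b : ℝ) / R) ^ 2 * Real.exp (3 * b / R)) ^ k with hq
  have hq0 : 0 ≤ q := by rw [hq]; positivity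
  rw [fwdDiff_iter_one_sum_mul X ψ (fun x j' => shellLaw π S H (2 * s₀ + c₀) (c₀ + 2 * j') (x - m)) k j]
  calc |∑ x ∈ X, ψ x * (fwdDiff (1 : ℕ))^[k] (fun j' => shellLaw π S H (2 * s₀ + c₀) (c₀ + 2 * j') (x - m)) j|
      ≤ ∑ x ∈ X, |ψ x * (fwdDiff (1 : ℕ))^[k] (fun j' => shellLaw π S H (2 * s₀ + c₀) (c₀ + 2 * j') (x - m)) j| :=
        abs_sum_le_sum_abs _ _
    _ ≤ ∑ x ∈ X, G * (q * shellLaw π S H (2 * s₀ + c₀) (c₀ + 2 * j) (x - m)) := sum_le_sum fun x hx => by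
        rw [abs_mul]
        exact mul_le_mul (hG x hx) (abs_fwdDiff_iter_shellLaw_le_int hπ hπ' hS hN H h0 hb hR hR1 hR2 (x - m))
          (abs_nonneg _) hG0
    _ = G * (q * ∑ x ∈ X, shellLaw π S H (2 * s₀ + c₀) (c₀ + 2 * j) (x - m)) := by rw [mul_sum, mul_sum]
    _ ≤ G * (q * 1) := mul_le_mul_of_nonneg_left
        (mul_le_mul_of_nonneg_left (sum_shellLaw_sub_le_one π S H _ _ X m) hq0) hG0
    _ = G * q := by rw [mul_one]

/-- **The brick-121 input at every integer point (odd cut, base index).** For `S`, `H`, `b` as above, `t = 2s₀+1`,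
`R ≥ 1` with `R + 3D + b ≤ s₀ + 1`, `R + 3D + b + s₀ + 1 ≤ N` and `(b/R)²e^{3b/R} ≤ 2`: for EVERY `x ∈ ℤ`,
`Σ_{k=1}^{D} (C(2k,k)/4^k)·|Δ^k_j[law_S(t, 1+2j; x)](0)| ≤ law_S(t, 1; x)` (`C(2k,k) ≤ 4^k`, `Σ_{k≥1} q^k ≤ 1` for `q ≤ ½`).
[cite: Rothvoss2017, §2 (PDF p. 6)] [cite: Feller1968, Ch. III §2] -/
theorem sum_centralBinom_mul_abs_fwdDiff_iter_shellLaw_le {S : Finset (Fin n)} (hS : ∀ v ∈ S, π v ∈ S) {N : ℕ}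
    (hN : S.card = 2 * N) (H : Finset (Fin n)) (h0 : (reps π (vAA π S H)).card = 0) {b : ℕ}
    (hb : (reps π (vBH π S H ∪ vBN π S H)).card = b) {s₀ D R : ℕ} (hR : 1 ≤ R)
    (hR1 : R + 3 * D + b ≤ s₀ + 1) (hR2 : R + 3 * D + b + s₀ + 1 ≤ N)
    (hq : ((b : ℝ) / R) ^ 2 * Real.exp (3 * b / R) ≤ 2) (x : ℤ) :
    ∑ k ∈ Ico 1 (D + 1), (((2 * k).choose k : ℕ) : ℝ) / (4 : ℝ) ^ k *
        |(fwdDiff (1 : ℕ))^[k] (fun j => shellLaw π S H (2 * s₀ + 1) (1 + 2 * j) x) 0| ≤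
      shellLaw π S H (2 * s₀ + 1) 1 x := by
  set q : ℝ := (1 / 4 : ℝ) * ((b : ℝ) / R) ^ 2 * Real.exp (3 * b / R) with hqdef
  have hq0 : 0 ≤ q := by rw [hqdef]; positivity
  have hq2 : q ≤ 1 / 2 := by rw [hqdef]; linarith
  have hlaw0 : 0 ≤ shellLaw π S H (2 * s₀ + 1) 1 x := by rw [shellLaw, shellCount]; positivity
  have hcb : ∀ k : ℕ, (((2 * k).choose k : ℕ) : ℝ) / (4 : ℝ) ^ k ≤ 1 := fun k => by
    have h := Nat.choose_le_two_pow (2 * k) k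
    have h' : (((2 * k).choose k : ℕ) : ℝ) ≤ (4 : ℝ) ^ k := by
      calc (((2 * k).choose k : ℕ) : ℝ) ≤ (2 : ℝ) ^ (2 * k) := by exact_mod_cast h
        _ = (4 : ℝ) ^ k := by rw [pow_mul]; norm_num
    exact div_le_one_of_le₀ h' (by positivity)
  have hterm : ∀ k ∈ Ico 1 (D + 1), (((2 * k).choose k : ℕ) : ℝ) / (4 : ℝ) ^ k *
      |(fwdDiff (1 : ℕ))^[k] (fun j => shellLaw π S H (2 * s₀ + 1) (1 + 2 * j) x) 0| ≤
        q ^ k * shellLaw π S H (2 * s₀ + 1) 1 x := by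
    intro k hk
    have hkD : k ≤ D := by have := (mem_Ico.1 hk).2; omega
    have h := abs_fwdDiff_iter_shellLaw_le_int hπ hπ' hS hN H h0 hb (c₀ := 1) (s₀ := s₀) (k := k) (j := 0) hR
      (by omega) (by omega) x
    rw [← hqdef, mul_zero, add_zero] at h
    calc _ ≤ 1 * (q ^ k * shellLaw π S H (2 * s₀ + 1) 1 x) :=
          mul_le_mul (hcb k) h (abs_nonneg _) zero_le_one
      _ = _ := one_mul _
  have hgeom : ∑ k ∈ Ico 1 (D + 1), q ^ k ≤ 1 := by
    have hq1 : q < 1 := by linarith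
    rw [geom_sum_Ico hq1.ne (by omega : 1 ≤ D + 1), div_le_iff_of_neg (by linarith), pow_one]
    have hqD : 0 ≤ q ^ (D + 1) := pow_nonneg hq0 _
    linarith
  calc _ ≤ ∑ k ∈ Ico 1 (D + 1), q ^ k * shellLaw π S H (2 * s₀ + 1) 1 x := sum_le_sum hterm
    _ = (∑ k ∈ Ico 1 (D + 1), q ^ k) * shellLaw π S H (2 * s₀ + 1) 1 x := by rw [sum_mul]
    _ ≤ 1 * shellLaw π S H (2 * s₀ + 1) 1 x := mul_le_mul_of_nonneg_right hgeom hlaw0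
    _ = _ := one_mul _

end MainShift

end ShellStep

end Literature.Combinatorics.Optimization

end
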